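/-
Copyright (c) 2026. All rights reserved.
Released under Apache 2.0 license as described in the file LICENSE.
-/
import Summits.NavierStokesRegularity.FluidComputer.RowCircuitSection
import Summits.NavierStokesRegularity.FluidComputer.RowReentry
import HarnessLib

/-!
# The scale-induction step of the toy circuit, closed up to the re-entry certificate

HONEST FRAMING (cell `pub-fluidc`, blueprint seat bp3, gen 23): low prior, high value-of-information
experiment on Tao's machine paradigm; NOT a claim that NS blows up. Everything here concerns the
9-mode TOY chain `F gK ΛK` (R1-DESIGN §7–§12); nothing is claimed about Navier–Stokes.

`I(n) ⇒ I(n+1)` as a SELF-MAP OF A BOX OF START STATES. The re-entry box `reBox` pins the carrier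
and lock (`a₁ = X0 0`, `b₁ = X0 1`), lets the residues `c₁ d₁` and the next-carrier seed `a₂` range
over the section read-out box `ctr ± wid` of `RowChain.secCert` (the induction box `B'` of
R1-DESIGN §12) and the fresh gate's modes `b₂ c₂ d₂ e₂` over the quiet box `Q1C ± Q1W`.
`renorm v qm` is the renormalised next-scale start state read off a section state `v`
(`b₂ = ρ·a₂`): amplitudes scaled by `X0 0 / a₂` (the model's exact scaling symmetry,
`CircuitFlow.solution_smul/speed`), the old second gate playing the first, fresh quiet modes `qm`.

* `renorm_mem` — at a certified section state the renormalised state lies in `reBox` again,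
  GIVEN quiet fresh modes (`|qm − Q1C| ≤ Q1W`: the interface axiom "quiet start of the next
  gate", discharged at twin level by the passive-window certificate P2, not in Lean);
* `induction_step_of` — **the Lean-level induction step**: IF row `0`'s start tube box contains
  `reBox` (`reentryOK (row 0) reBox`, a `native_decide` on the chain of record) THEN every state of
  `reBox` is carried by the exact circuit, at a time `|τ − 19/20| ≤ 3/500`, to a section state
  whose renormalisation lies in `reBox` for every admissible choice of fresh quiet modes, with
  the level `ℓ' = b₂/bmid ∈ [0.9673, 0.9718]` (the amplitude factor of the step is `1/ℓ'`).

STATUS OF THE HYPOTHESIS. On the chain of record in the tree at the time of writing (k53d, start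
box = PostBox18L) `reentryOK (row 0) reBox` is FALSE (B' is wider than PostBox18L in `d₁, a₂`);
on the gen-23 chain k54b (start box = B' itself; 1066 rows, all certificates re-decided, staged
under `pub-fluidc-bp3/lean/g23/swap_k54b/`) it is TRUE (`section23.py` R-line ratios ≤ 1.0000,
Lean scratch `native_decide`). After the k54b table swap the one-line corollary
`induction_step := induction_step_of (by native_decide)` closes the loop. COMPUTATIONAL
(transitively `Lean.ofReduceBool` through the chain cone). No `sorry`, no new axioms.
-/

namespace Summit.NavierStokesRegularity.FluidComputer

open Literature.Analysis.FluidPDE.FluidComputer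

namespace RowChain

open RowCheck RowCheck.RowData RowRun ChainField Set

/-- Quiet-box centre of the fresh gate's modes `b₂ c₂ d₂ e₂` (= the designed start values). [folklore] -/
def Q1C (m : Fin 4) : ℚ := X0Q ⟨5 + m, by omega⟩

/-- Quiet-box radii (level-normalised; R1-DESIGN §12, `section_k54b.json` `box.q1w`). [folklore] -/
def Q1W : Fin 4 → ℚ :=
  ![4722366482869645 / 2 ^ 70, 3022314549036573 / 2 ^ 77, 944473296573929 / 2 ^ 71,
    3022314549036573 / 2 ^ 77]

/-- **The re-entry box** `a₁ b₁` pinned, `c₁ d₁ a₂ ∈ ctr ± wid`, `b₂ c₂ d₂ e₂ ∈ Q1C ± Q1W`. [folklore] -/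
def reBox : ReBox where
  cen := ![X0Q 0, X0Q 1, secCert.ctr 0, secCert.ctr 1, secCert.ctr 2, Q1C 0, Q1C 1, Q1C 2, Q1C 3]
  rad := ![0, 0, secCert.wid 0, secCert.wid 1, secCert.wid 2, Q1W 0, Q1W 1, Q1W 2, Q1W 3]

/-- **Renormalised next-scale start state** read off a section state `v` with fresh quiet modes
`qm`. [folklore] -/
noncomputable def renorm (v : Fin 9 → ℝ) (qm : Fin 4 → ℝ) : Fin 9 → ℝ :=
  ![X0 0, X0 1, X0 0 * v 6 / v 4, X0 0 * v 7 / v 4, X0 0 * v 8 / v 4, qm 0, qm 1, qm 2, qm 3]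

/-- [folklore] -/
theorem X0Q_ne : X0Q 0 ≠ 0 ∧ X0Q 1 ≠ 0 := by
  native_decide

/-- The read-out functional of the section certificate IS the renormalised coordinate. [folklore] -/
theorem readout_eq {v : Fin 9 → ℝ} (hsec : v 5 = (secCert.rho : ℝ) * v 4) (a : Fin 9) :
    (secCert.bmid : ℝ) * v a / v 5 = X0 0 * v a / v 4 := by
  have h0 : ((X0Q 0 : ℚ) : ℝ) ≠ 0 := by exact_mod_cast X0Q_ne.1
  have h1 : ((X0Q 1 : ℚ) : ℝ) ≠ 0 := by exact_mod_cast X0Q_ne.2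
  have hr : (secCert.rho : ℝ) = (X0Q 1 : ℝ) / X0Q 0 := by
    show ((X0Q 1 / X0Q 0 : ℚ) : ℝ) = _; push_cast; rfl
  have hb : (secCert.bmid : ℝ) = (X0Q 1 : ℝ) := rfl
  rw [hsec, hr, hb, X0_eq]
  by_cases h4 : v 4 = 0
  · simp [h4]
  · field_simp

/-- **Re-entry of the renormalised state**, given quiet fresh modes. [folklore] -/
theorem renorm_mem {v : Fin 9 → ℝ} {qm : Fin 4 → ℝ} (hsec : v 5 = (secCert.rho : ℝ) * v 4)
    (hrd : ∀ j : Fin 3, |(secCert.bmid : ℝ) * v (rdIdx j) / v 5 - secCert.ctr j| ≤ secCert.wid j)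
    (hq : ∀ m : Fin 4, |qm m - (Q1C m : ℝ)| ≤ Q1W m) :
    ∀ b, |renorm v qm b - (reBox.cen b : ℝ)| ≤ reBox.rad b := by
  have hc : ∀ j : Fin 3, |X0 0 * v (rdIdx j) / v 4 - secCert.ctr j| ≤ secCert.wid j := fun j => by
    rw [← readout_eq hsec]; exact hrd j
  have h2 := hc 0; have h3 := hc 1; have h4 := hc 2
  have h5 := hq 0; have h6 := hq 1; have h7 := hq 2; have h8 := hq 3
  simp only [rdIdx] at h2 h3 h4
  intro b
  fin_cases b
  · simp [renorm, reBox, X0_eq]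
  · simp [renorm, reBox, X0_eq]
  · simpa [renorm, reBox] using h2
  · simpa [renorm, reBox] using h3
  · simpa [renorm, reBox] using h4
  · simpa [renorm, reBox] using h5
  · simpa [renorm, reBox] using h6
  · simpa [renorm, reBox] using h7
  · simpa [renorm, reBox] using h8

/-- **The induction step `I(n) ⇒ I(n+1)` of the exact circuit, up to the re-entry certificate.**
[folklore] -/
theorem induction_step_of (hre : reentryOK (row 0) reBox = true) (q₀ : Fin 9 → ℝ)
    (hq : ∀ b, |q₀ b - (reBox.cen b : ℝ)| ≤ reBox.rad b) :
    ∃ y : ℝ → Fin 9 → ℝ, y 0 = q₀ ∧ (∀ σ, HasDerivAt y (F gK ΛK (y σ)) σ) ∧ ∃ τ : ℝ,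
      |τ - 19 / 20| ≤ 3 / 500 ∧ 0 < y τ 4 ∧ y τ 5 = (secCert.rho : ℝ) * y τ 4 ∧
      ((secCert.levLo : ℝ) ≤ y τ 5 / secCert.bmid ∧ y τ 5 / secCert.bmid ≤ secCert.levHi) ∧
      ∀ qm : Fin 4 → ℝ, (∀ m, |qm m - (Q1C m : ℝ)| ≤ Q1W m) →
        ∀ b, |renorm (y τ) qm b - (reBox.cen b : ℝ)| ≤ reBox.rad b := by
  have hp : (row 0).p = 1 := start_readout.1
  have hlock : q₀ (row 0).p = X0 (row 0).p := by
    have h' : |q₀ 1 - (X0Q 1 : ℝ)| ≤ 0 := by simpa [reBox] using hq 1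
    rw [hp, X0_eq]
    exact sub_eq_zero.mp (abs_nonpos_iff.mp h')
  have hbox : ∀ i, |z0 q₀ i| ≤ (row 0).ubR 0 i := fun i =>
    reentry_sound hre (framesOK_row 0) hq i
  obtain ⟨y, hy0, hsol, τ, hτ, hsec, h4, hlev, hrd⟩ := circuit_section_from q₀ hlock hbox
  exact ⟨y, hy0, hsol, τ, hτ, h4, hsec, hlev, fun qm hqm => renorm_mem hsec hrd hqm⟩

end RowChain

end Summit.NavierStokesRegularity.FluidComputer
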